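import Summits.QuantumFields.YangMills.Theses.ForcedResponseSkewness
import Summits.QuantumFields.YangMills.Theorems.ForcedResponseSkewnessFemtoEngineDefs
import Summits.QuantumFields.YangMills.Theorems.ForcedResponseSkewnessRunningCouplingCeilingOfFBL6FemtoLog
import Summits.QuantumFields.YangMills.Theorems.ForcedResponseSkewnessRunningCouplingCeilingFemtoLogOfCentred
import Summits.QuantumFields.YangMills.Theorems.ForcedResponseSkewnessFemtoOfFBL6
import Summits.QuantumFields.YangMills.Theorems.BalabanLadderNTBoundaryLawOscillation

/-!
# Skeleton «pointwise-log-ceiling-r» v6 for the crux `RunningCouplingCeiling` (stmt-QuantumFields-24275; route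
# `ForcedResponseSkewness`; lead `ym-line-frs-p1` g4 (v4, frs-p3's femto reshape), g5 (v5, engine form of the AF stub) and g6 (v6,
# engine form of the shared E0′ stub), 2026-08-28)

v6 (lead g6): the shared E0′ stub is registered in ENGINE FORM — `FBL6OscSigR`, the plane-resolved frozen-boundary law as a
REFERENCE-FREE two-exterior OSCILLATION bound for ONE plaquette orientation at the centre of the centred femto cubes `[-R,R]⁴`
(Defs volume `Theorems/ForcedResponseSkewnessFemtoEngineDefs.lean`; verbatim the hypothesis of the spine's landed
`Cruxes.NT.BoundaryLaw.fbl6_of_oscillation`).  v5's E0′ stub statement `FBL6PinnedSigR` is DERIVED (`fbl6Pinned_holds`); the AF stub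
`stub_centredFemtoLog : CentredFemtoLogSigR` and the composition are unchanged.  With this both physics stubs of the crux live on ONE
family of cubes (centred femto cubes along the pinned unit, the centre, arbitrary exteriors), and the route's whole physics debt outside
the residual is the bundle `FemtoEngineSigR = FBL6OscSigR ∧ CentredOscLawSigR ∧ CentredFemtoLogSigR` (certificate
`FemtoEngine.nt_of_femtoEngine`, file `Theorems/ForcedResponseSkewnessFemtoEngineInterface.lean`).

RunningCouplingCeiling ⇐ stub_fbl6Osc           (E0′/FEMTO engine stub in oscillation form; SHARED with the deciding crux 26871 and
                                                  with the spine's crux 19353 engine target E1)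
                       + stub_centredFemtoLog   (AF/FEMTO, ENGINE FORM: the log two-point ceiling for the pairs `(0, y)` of the centred
                                                  cubes `[-N,N]⁴`, every exterior; THE debt of this crux)
                       + LANDED analysis:       `fbl6_of_oscillation` (spine), `fblPinnedSigR_of_fbl6` (p607908),
                                                  `femtoLogSigR_of_centred` (g5 p622058), `runningCouplingCeiling_of_fbl6_femtoLog`
                                                  (frs-p3 p610011).
No summit is proved by any of this (leaf R2a `BalabanLadder.NT`, conditional rung line; the YM mass gap is NOT proved).
-/

set_option autoImplicit false

noncomputable section

namespace Summit.QuantumFields.YangMills.Cruxes.RunningCouplingCeiling.Pointwise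

open Summit.QuantumFields.YangMills.Cruxes.ResponseLocalisation.Birth (FBL6PinnedSigR FBL6OscSigR)
open Summit.QuantumFields.YangMills.Cruxes.ResponseLocalisation.Femto (fblPinnedSigR_of_fbl6)
open Summit.QuantumFields.YangMills.Cruxes.RunningCouplingCeiling.CentredLog (femtoLogSigR_of_centred)
open Summit.QuantumFields.YangMills.Cruxes.NT.BoundaryLaw (fbl6_of_oscillation)
open Summit.QuantumFields.YangMills.Theses.ForcedResponseSkewness

/-! ## The registered stubs -/

/-- E0′/FEMTO engine stub in ENGINE FORM (shared with crux 26871 and the spine's crux 19353): the plane-resolved frozen-boundary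
law as a reference-free two-exterior oscillation bound for one plaquette orientation at the centre of the centred femto cubes,
along a pinned unit. -/
theorem stub_fbl6Osc : FBL6OscSigR := by
  sorry

/-- AF/FEMTO stub in ENGINE FORM (the crux's debt): the femto log two-point ceiling at the centre of the centred cubes along a
pinned unit. -/
theorem stub_centredFemtoLog : CentredFemtoLogSigR := by
  sorry

/-! ## Derived statements (kernel-checked reductions) -/

/-- DERIVED (g6, spine reduction `fbl6_of_oscillation` along the pinned unit): v5's E0′ stub statement. -/
theorem fbl6Pinned_holds : FBL6PinnedSigR := by
  intro G _ _ _ _ hG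
  letI : MeasurableSpace G := borel G
  haveI : BorelSpace G := ⟨rfl⟩
  intro r a hpos hlim hpin
  obtain ⟨D, C₁, β₁, ℓ₁, hℓ₁, H⟩ := stub_fbl6Osc G hG r a hpos hlim hpin
  exact fbl6_of_oscillation G r a hpos D ⟨C₁, β₁, ℓ₁, hℓ₁, H⟩

/-- DERIVED (g5 reduction, kernel-checked): v4's AF stub statement. -/
theorem femtoLog_holds : FemtoLogSigR :=
  femtoLogSigR_of_centred (fblPinnedSigR_of_fbl6 fbl6Pinned_holds) stub_centredFemtoLog

/-- COMPOSITION (kernel-checked): the crux BY NAME; the only `sorry`s are the two PHYSICS stubs. -/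
theorem RunningCouplingCeiling_holds : RunningCouplingCeiling :=
  runningCouplingCeiling_of_fbl6_femtoLog fbl6Pinned_holds femtoLog_holds

end Summit.QuantumFields.YangMills.Cruxes.RunningCouplingCeiling.Pointwise

end
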